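import Literature.NumberTheory.Sieve.SelbergSieveGBox
import HarnessLib

/-!
# Interval Möbius cancellation on the Selberg box (the coupling sum of Maynard's Prop. 9.4)

Source: J. Maynard, *Dense clusters of primes in subsets*, Compositio Math. 152 (2016) =
arXiv:1405.2593 [Maynard2016DenseClusters], proof of Proposition 9.4 pp. 25–26. There the
`(k+1)`-dimensional weights `λ_{d⁺} = λ_d · λ̃_{d₀}` live on the box with the extra constraint
`(∏ d, d₀) = 1`, and the change of variables to `y⁺ = dualY λ⁺` produces, after inserting the
definitions of `λ` and `λ̃`, the COUPLING SUM
`B(r,g; r₀,g₀) = ∑_{r ∣ f ∣ g} ∑_{r₀ ∣ f₀ ∣ g₀} [(∏f, f₀) = 1] μ(∏f) μ(f₀)`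
(P94-SPEC §1d′). Its key property — `B = 0` as soon as some prime of `g` outside `r` does not divide
`g₀` — is an instance of the following generic cancellation, proved here once on the general box
`SelbergBox.gBox` (the involution `f_j ↦ f_j p^{±1}` of `SelbergBox.sum_filter_dvd_pairTerm_eq_zero`
with an arbitrary invariant weight), together with its one-dimensional (`ℕ`) version for the `f₀`-sum:

* **`sum_interval_moebius_mul_eq_zero`** — for `g ∈ gBox`, any `r`, a prime `p ∣ g_j` with `p ∤ r_j`,
  and any weight `w` invariant under `f ↦ f·p^{±1}` at `j` on the interval `r ∣ f ∣ g`: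
  `∑_{f ∈ gBox, r ∣ f ∣ g} μ(∏ f) w(f) = 0`;
* **`sum_divisors_interval_moebius_mul_eq_zero`** — the same on `ℕ`: for squarefree `g`, any `r`,
  a prime `p ∣ g`, `p ∤ r` and `w` invariant under `f ↦ f p^{±1}`: `∑_{f ∣ g, r ∣ f} μ(f) w(f) = 0`.

## References
* J. Maynard, *Dense clusters of primes in subsets*, Compositio Math. 152 (2016), proof of Prop. 9.4
  pp. 25–26 [Maynard2016DenseClusters].
-/

noncomputable section

open Finset
open scoped ArithmeticFunction.Moebius

namespace Literature.NumberTheory.Sieve.SelbergBox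

variable {ι : Type*} [Fintype ι] [DecidableEq ι]

/-- **Interval Möbius cancellation on the box.** For `g ∈ gBox N W`, any lower end `r`, a prime
`p ∣ g_j` with `p ∤ r_j`, and a weight `w` invariant (on the interval `r ∣ f ∣ g`) under the toggle
`f_j ↦ f_j / p` (if `p ∣ f_j`) resp. `f_j p`: `∑_{f ∈ gBox, r ∣ f ∣ g} μ(∏ f_i) · w(f) = 0`.
Applied with `w(f) = [(∏ f, f₀) = 1] · c` (invariant when `p ∤ f₀`) this is the vanishing of the
coupling sum `B` of the proof of Prop. 9.4.
[cite: Maynard2016DenseClusters, proof of Prop. 9.4 p. 25 (change of variables for the (k+1)-dimensional sieve); proof of Prop. 9.1 p. 19 (the involution d_j ↦ d_j p^{±1})] -/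
theorem sum_interval_moebius_mul_eq_zero {N W : ι → ℕ} {r g : ι → ℕ} (hg : g ∈ gBox N W)
    {p : ℕ} (hp : p.Prime) {j : ι} (hpg : p ∣ g j) (hpr : ¬ p ∣ r j)
    (w : (ι → ℕ) → ℝ)
    (hw : ∀ f : ι → ℕ, (∀ i, r i ∣ f i) → (∀ i, f i ∣ g i) →
      w (Function.update f j (if p ∣ f j then f j / p else f j * p)) = w f) :
    ∑ f ∈ (gBox N W).filter (fun f => (∀ i, r i ∣ f i) ∧ ∀ i, f i ∣ g i),
      ((μ (∏ i, f i) : ℤ) : ℝ) * w f = 0 := by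
  have hpprime : Prime p := Nat.prime_iff.1 hp
  have moebius_prime_mul_of_not_dvd : ∀ {q m : ℕ}, q.Prime → ¬ q ∣ m → μ (q * m) = -μ m :=
    fun {q m} hq hqm => by
      rw [ArithmeticFunction.isMultiplicative_moebius.map_mul_of_coprime
          ((Nat.Prime.coprime_iff_not_dvd hq).2 hqm), ArithmeticFunction.moebius_apply_prime hq]
      ring
  have hgsq : Squarefree (g j) := squarefree_apply_of_mem_gBox hg j
  set tog : (ι → ℕ) → (ι → ℕ) := fun f =>
    Function.update f j (if p ∣ f j then f j / p else f j * p) with htog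
  -- no other coordinate of a divisor vector of `g` is divisible by `p`
  have hfi : ∀ f : ι → ℕ, (∀ i, f i ∣ g i) → ∀ i, i ≠ j → ¬ p ∣ f i := by
    intro f hf i hij h
    have hgcd := Nat.dvd_gcd (h.trans (hf i)) hpg
    rw [(coprime_apply_of_mem_gBox hg hij).gcd_eq_one] at hgcd
    exact hp.one_lt.ne' (Nat.dvd_one.1 hgcd)
  have hdivndvd : ∀ f : ι → ℕ, (∀ i, f i ∣ g i) → p ∣ f j → ¬ p ∣ f j / p := by
    intro f hf hpf h
    rw [Nat.dvd_div_iff_mul_dvd hpf] at h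
    exact hp.not_isUnit ((hgsq.squarefree_of_dvd (hf j)) p h)
  have hpr' : p.Coprime (r j) := (Nat.Prime.coprime_iff_not_dvd hp).2 hpr
  -- `tog` preserves the interval
  have htog_dvd : ∀ f : ι → ℕ, (∀ i, f i ∣ g i) → ∀ i, tog f i ∣ g i := by
    intro f hf i
    by_cases hi : i = j
    · subst hi
      simp only [htog, Function.update_self]
      split_ifs with hpf
      · exact (Nat.div_dvd_of_dvd hpf).trans (hf i)
      · exact Nat.Coprime.mul_dvd_of_dvd_of_dvd
          (Nat.coprime_comm.1 ((Nat.Prime.coprime_iff_not_dvd hp).2 hpf)) (hf i) hpg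
    · simp only [htog, Function.update_of_ne hi]; exact hf i
  have htog_ge : ∀ f : ι → ℕ, (∀ i, r i ∣ f i) → ∀ i, r i ∣ tog f i := by
    intro f hf i
    by_cases hi : i = j
    · subst hi
      simp only [htog, Function.update_self]
      split_ifs with hpf
      · have h1 : r i ∣ p * (f i / p) := by rw [Nat.mul_div_cancel' hpf]; exact hf i
        exact (Nat.coprime_comm.1 hpr').dvd_of_dvd_mul_left h1
      · exact (hf i).mul_right p
    · simp only [htog, Function.update_of_ne hi]; exact hf i
  refine Finset.sum_involution (fun f _ => tog f) ?_ ?_ ?_ ?_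
  · -- the two terms cancel: `μ` flips, `w` is invariant
    intro f hf
    obtain ⟨-, hfr, hfg⟩ := Finset.mem_filter.1 hf
    have hP0 : ∏ i, f i = f j * ∏ i ∈ Finset.univ \ {j}, f i := by
      conv_lhs => rw [← Function.update_eq_self j f]
      exact Finset.prod_update_of_mem (Finset.mem_univ j) f (f j)
    have hP1 : ∏ i, tog f i =
        (if p ∣ f j then f j / p else f j * p) * ∏ i ∈ Finset.univ \ {j}, f i := by
      simp only [htog]; exact Finset.prod_update_of_mem (Finset.mem_univ j) f _
    have hrest : ¬ p ∣ ∏ i ∈ Finset.univ \ {j}, f i := by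
      rw [hpprime.dvd_finsetProd_iff]
      rintro ⟨i, hi, hpi⟩
      exact hfi f hfg i (by simpa using hi) hpi
    have hμ : ((μ (∏ i, tog f i) : ℤ) : ℝ) = -((μ (∏ i, f i) : ℤ) : ℝ) := by
      rw [hP1, hP0]
      split_ifs with hpf
      · have h1 : f j * ∏ i ∈ Finset.univ \ {j}, f i =
            p * (f j / p * ∏ i ∈ Finset.univ \ {j}, f i) := by
          conv_lhs => rw [← Nat.div_mul_cancel hpf]
          ring
        have hnd : ¬ p ∣ f j / p * ∏ i ∈ Finset.univ \ {j}, f i := by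
          rw [hp.dvd_mul, not_or]; exact ⟨hdivndvd f hfg hpf, hrest⟩
        rw [h1, moebius_prime_mul_of_not_dvd hp hnd]; push_cast; ring
      · have h1 : f j * p * ∏ i ∈ Finset.univ \ {j}, f i =
            p * (f j * ∏ i ∈ Finset.univ \ {j}, f i) := by ring
        have hnd : ¬ p ∣ f j * ∏ i ∈ Finset.univ \ {j}, f i := by
          rw [hp.dvd_mul, not_or]; exact ⟨hpf, hrest⟩
        rw [h1, moebius_prime_mul_of_not_dvd hp hnd]; push_cast; ring
    have hwf : w (tog f) = w f := hw f hfr hfg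
    rw [hμ, hwf]; ring
  · intro f hf _ h
    obtain ⟨-, -, hfg⟩ := Finset.mem_filter.1 hf
    have hj := congr_fun h j
    simp only [htog, Function.update_self] at hj
    have hf1 : 1 ≤ f j := one_le_of_mem_gBox (mem_gBox_of_dvd hg hfg) j
    split_ifs at hj with hpf
    · exact (Nat.div_lt_self hf1 hp.one_lt).ne hj
    · have : f j * p = f j * 1 := by rw [hj, mul_one]
      exact hp.one_lt.ne' (Nat.eq_of_mul_eq_mul_left hf1 this)
  · intro f hf
    obtain ⟨-, hfr, hfg⟩ := Finset.mem_filter.1 hf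
    exact Finset.mem_filter.2 ⟨mem_gBox_of_dvd hg (htog_dvd f hfg), htog_ge f hfr, htog_dvd f hfg⟩
  · intro f hf
    obtain ⟨-, -, hfg⟩ := Finset.mem_filter.1 hf
    funext i
    by_cases hi : i = j
    · subst hi
      simp only [htog, Function.update_self]
      split_ifs with hpf h2 h3
      · exact absurd h2 (hdivndvd f hfg hpf)
      · exact Nat.div_mul_cancel hpf
      · exact Nat.mul_div_cancel _ hp.pos
      · exact absurd (Dvd.intro_left _ rfl) h3
    · simp only [htog, Function.update_of_ne hi]

omit [Fintype ι] [DecidableEq ι] in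
/-- **Interval Möbius cancellation on `ℕ`** (the `f₀`-sum of the coupling sum `B`): for squarefree
`g`, any `r`, a prime `p ∣ g` with `p ∤ r`, and a weight `w` invariant under `f ↦ f/p` (if `p ∣ f`)
resp. `f p` on `{f : r ∣ f ∣ g}`: `∑_{f ∣ g, r ∣ f} μ(f) w(f) = 0`.
[cite: Maynard2016DenseClusters, proof of Prop. 9.4 p. 25 (the extra coordinate r₀ ∣ f₀ ∣ g₀)] -/
theorem sum_divisors_interval_moebius_mul_eq_zero {r g : ℕ} (hg : Squarefree g)
    {p : ℕ} (hp : p.Prime) (hpg : p ∣ g) (hpr : ¬ p ∣ r) (w : ℕ → ℝ)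
    (hw : ∀ f : ℕ, r ∣ f → f ∣ g → w (if p ∣ f then f / p else f * p) = w f) :
    ∑ f ∈ g.divisors.filter (fun f => r ∣ f), ((μ f : ℤ) : ℝ) * w f = 0 := by
  have hg0 : g ≠ 0 := hg.ne_zero
  have moebius_prime_mul_of_not_dvd : ∀ {q m : ℕ}, q.Prime → ¬ q ∣ m → μ (q * m) = -μ m :=
    fun {q m} hq hqm => by
      rw [ArithmeticFunction.isMultiplicative_moebius.map_mul_of_coprime
          ((Nat.Prime.coprime_iff_not_dvd hq).2 hqm), ArithmeticFunction.moebius_apply_prime hq]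
      ring
  have hpr' : p.Coprime r := (Nat.Prime.coprime_iff_not_dvd hp).2 hpr
  set tog : ℕ → ℕ := fun f => if p ∣ f then f / p else f * p with htog
  have hdivndvd : ∀ f : ℕ, f ∣ g → p ∣ f → ¬ p ∣ f / p := by
    intro f hf hpf h
    rw [Nat.dvd_div_iff_mul_dvd hpf] at h
    exact hp.not_isUnit ((hg.squarefree_of_dvd hf) p h)
  have htog_dvd : ∀ f : ℕ, f ∣ g → tog f ∣ g := by
    intro f hf
    simp only [htog]
    split_ifs with hpf
    · exact (Nat.div_dvd_of_dvd hpf).trans hf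
    · exact Nat.Coprime.mul_dvd_of_dvd_of_dvd
        (Nat.coprime_comm.1 ((Nat.Prime.coprime_iff_not_dvd hp).2 hpf)) hf hpg
  have htog_ge : ∀ f : ℕ, r ∣ f → r ∣ tog f := by
    intro f hf
    simp only [htog]
    split_ifs with hpf
    · have h1 : r ∣ p * (f / p) := by rw [Nat.mul_div_cancel' hpf]; exact hf
      exact (Nat.coprime_comm.1 hpr').dvd_of_dvd_mul_left h1
    · exact hf.mul_right p
  refine Finset.sum_involution (fun f _ => tog f) ?_ ?_ ?_ ?_
  · intro f hf
    obtain ⟨hfd, hfr⟩ := Finset.mem_filter.1 hf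
    have hfg : f ∣ g := (Nat.mem_divisors.1 hfd).1
    have hμ : ((μ (tog f) : ℤ) : ℝ) = -((μ f : ℤ) : ℝ) := by
      simp only [htog]
      split_ifs with hpf
      · have h1 : f = p * (f / p) := (Nat.mul_div_cancel' hpf).symm
        conv_rhs => rw [h1]
        rw [moebius_prime_mul_of_not_dvd hp (hdivndvd f hfg hpf)]; push_cast; ring
      · rw [mul_comm, moebius_prime_mul_of_not_dvd hp hpf]; push_cast; ring
    have hwf : w (tog f) = w f := hw f hfr hfg
    rw [hμ, hwf]; ring
  · intro f hf _ h
    obtain ⟨hfd, -⟩ := Finset.mem_filter.1 hf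
    have hf1 : 1 ≤ f := Nat.pos_of_mem_divisors hfd
    simp only [htog] at h
    split_ifs at h with hpf
    · exact (Nat.div_lt_self hf1 hp.one_lt).ne h
    · have : f * p = f * 1 := by rw [h, mul_one]
      exact hp.one_lt.ne' (Nat.eq_of_mul_eq_mul_left hf1 this)
  · intro f hf
    obtain ⟨hfd, hfr⟩ := Finset.mem_filter.1 hf
    have hfg : f ∣ g := (Nat.mem_divisors.1 hfd).1
    exact Finset.mem_filter.2 ⟨Nat.mem_divisors.2 ⟨htog_dvd f hfg, hg0⟩, htog_ge f hfr⟩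
  · intro f hf
    obtain ⟨hfd, -⟩ := Finset.mem_filter.1 hf
    have hfg : f ∣ g := (Nat.mem_divisors.1 hfd).1
    simp only [htog]
    split_ifs with hpf h2 h3
    · exact absurd h2 (hdivndvd f hfg hpf)
    · exact Nat.div_mul_cancel hpf
    · exact Nat.mul_div_cancel _ hp.pos
    · exact absurd (Dvd.intro_left _ rfl) h3

/-- The coprimality weight is toggle-invariant: if `p ∤ n` then
`((f·p^{±1} at j)-product, n) = 1 ↔ (∏ f, n) = 1` — the hypothesis `hw` of
`sum_interval_moebius_mul_eq_zero` for `w(f) = [(∏ f, n) = 1]·c`.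
[cite: Maynard2016DenseClusters, proof of Prop. 9.4 p. 25 (the constraint (d, d₀) = 1 through W_{k+1})] -/
theorem coprime_prod_update_iff {f : ι → ℕ} {j : ι} {p n : ℕ} (hp : p.Prime) (hpn : ¬ p ∣ n) :
    (∏ i, Function.update f j (if p ∣ f j then f j / p else f j * p) i).Coprime n ↔
      (∏ i, f i).Coprime n := by
  have hP0 : ∏ i, f i = f j * ∏ i ∈ Finset.univ \ {j}, f i := by
    conv_lhs => rw [← Function.update_eq_self j f]
    exact Finset.prod_update_of_mem (Finset.mem_univ j) f (f j)
  have hP1 : ∏ i, Function.update f j (if p ∣ f j then f j / p else f j * p) i =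
      (if p ∣ f j then f j / p else f j * p) * ∏ i ∈ Finset.univ \ {j}, f i :=
    Finset.prod_update_of_mem (Finset.mem_univ j) f _
  have hpn' : p.Coprime n := (Nat.Prime.coprime_iff_not_dvd hp).2 hpn
  rw [hP1, hP0]
  split_ifs with hpf
  · conv_rhs => rw [← Nat.div_mul_cancel hpf]
    rw [Nat.coprime_mul_iff_left, Nat.coprime_mul_iff_left, Nat.coprime_mul_iff_left]
    exact ⟨fun h => ⟨⟨h.1, hpn'⟩, h.2⟩, fun h => ⟨h.1.1, h.2⟩⟩
  · rw [Nat.coprime_mul_iff_left, Nat.coprime_mul_iff_left, Nat.coprime_mul_iff_left]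
    exact ⟨fun h => ⟨h.1.1, h.2⟩, fun h => ⟨⟨h.1, hpn'⟩, h.2⟩⟩

omit [Fintype ι] [DecidableEq ι] in
/-- One-dimensional toggle invariance of a coprimality weight: if `p ∤ n` then
`(f p^{±1}, n) = 1 ↔ (f, n) = 1`. [cite: Maynard2016DenseClusters, proof of Prop. 9.4 p. 25] -/
theorem coprime_toggle_iff {f p n : ℕ} (hp : p.Prime) (hpn : ¬ p ∣ n) :
    (if p ∣ f then f / p else f * p).Coprime n ↔ f.Coprime n := by
  have hpn' : p.Coprime n := (Nat.Prime.coprime_iff_not_dvd hp).2 hpn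
  split_ifs with hpf
  · conv_rhs => rw [← Nat.div_mul_cancel hpf]
    rw [Nat.coprime_mul_iff_left]
    exact ⟨fun h => ⟨h, hpn'⟩, fun h => h.1⟩
  · rw [Nat.coprime_mul_iff_left]
    exact ⟨fun h => h.1, fun h => ⟨h, hpn'⟩⟩

end Literature.NumberTheory.Sieve.SelbergBox
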